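import Literature.NumberTheory.GaloisCohomology.Howard2004.UnramifiedSelfOrthogonal
import Literature.NumberTheory.EllipticCurves.TowerLiftableOfDualityProofs
import Literature.NumberTheory.GaloisRepresentations.LocalGlobalCohomologyFiniteProofs
import Literature.NumberTheory.GaloisRepresentations.LocalGlobalCohomologyDualityProofs
import HarnessLib

/-!
# Howard 2004, H.4: the `ℤ/p^k`-reading of the induced local pairing is PERFECT at every finite place
# (the level-`k` inputs (Perf)/(Nondeg) of the saturated-condition descent; proofs file)

Topic `NumberTheory/GaloisCohomology/Howard2004` (sequel to `DualityDatumTateDualBridge` / `UnramifiedSelfOrthogonal`; cell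
`pub/bsd-print-x9`, H4-DESCENT-RECIPE item 2).  THEOREMS ONLY; no definition, no named fact, no instance, no notation, no `sorry`.

Howard, §1.3 H.4 [arXiv:1202.6340 p. 7, L78–82] uses the local pairing `H¹(K_v, T) × H¹(K_v̄, T) → R` induced by `T × T → R(1)`
and local Tate duality.  In the tree the pairing is `D.localCup (inr v) : H¹(K_v, T) × H¹(K_v, Tw T) → H²(K_v, R(1))`; read
through a `ℤ_p`-semilinear character `λ : R → ℤ/p^k`, a trivialisation `exp : ℤ/p^k ≅ μ_{p^k}` and a local invariant map
`ι_v : H²(K_v, μ_{p^k}) → ℤ/p^k` it is the local Tate pairing against `Θ_* y`, `Θ = D.toTateDual λ exp : Tw T → T^∨(1)`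
(`cohomologyMap_localCup_eq_localTatePairing`).  Hence, for `Θ` bijective (`toTateDual_bijective`: `exp` bijective and `λ`
dualizing) and `ι_v` making the local Tate pairing of `T` perfect (the conjunct `IsPerfect` of the named fact
`poitouTate_selmerStructure_duality K`):

* `DualityDatum.localCupZMod_apply` — the reading `ι_v (H²(exp ∘ λ) (x ∪_e y)) = ⟨x, Θ_* y⟩_v` as the bi-additive map
  `(localTatePairingZMod ρ (p^k) v ι_v).compl₂ (H¹(Θ_v))`;
* **`DualityDatum.injective_localCupZMod` / `injective_localCupZMod_flip`** — both adjoints of the reading are injective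
  ((Nondeg) on both sides);
* **`DualityDatum.mem_of_forall_localCupZMod_annihilator_eq_zero`** — the double-annihilator property (Perf) of the H.4
  descent (`Tower.mem_of_forall_pairing_annihilator_eq_zero`, `H¹(K_v, ·)` finite and `p^k`-torsion): a class `y ∈ H¹(K_v, Tw T)`
  pairing to zero with the left annihilator of a subgroup `𝒯` lies in `𝒯`;
* `…_of_isPerfect` forms taking `inv : LocalInvariants K (p^k)` with `inv.IsPerfect`.

HONEST FRAMING: conditional on the local invariant maps (`LocalInvariants`/`IsPerfect`, vendored by the tree's Poitou–Tate named
fact, Milne I Cor. 2.3), exactly as `UnramifiedSelfOrthogonal`.  BSD is not proved by any of this.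

References: [Howard2004HeegnerKolyvagin] §1.3 H.4 (arXiv p. 7, L69–82), Def. 3.2.6; [MilneADT2006] Ch. I, Cor. 2.3, Prop. 0.19.
-/

set_option autoImplicit false

noncomputable section

open CategoryTheory Function NumberField IsDedekindDomain Field
open scoped ContRepresentation NumberField

namespace Literature.NumberTheory.GaloisCohomology.Howard2004

open Literature.NumberTheory.GaloisRepresentations
open Literature.NumberTheory.GaloisRepresentations.DiscreteGaloisModule
open Literature.NumberTheory.EllipticCurves (Tower.mem_of_forall_pairing_annihilator_eq_zero)

variable {K : Type} [Field K] [NumberField K] {M : Type} [AddCommGroup M] [TopologicalSpace M]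
  [DiscreteTopology M] {R : Type} [CommRing R] [Module R M] [TopologicalSpace R] [DiscreteTopology R]
  {p : ℕ} [Fact p.Prime] [Algebra ℤ_[p] R] {cd : ConjugationDatum K} {ρ : DiscreteGaloisModule K M}
  (D : DualityDatum p cd ρ R) {k : ℕ}
  (lam : R →+ ZMod (p ^ k))
  (hlam : ∀ (z : ℤ_[p]) (r : R), lam (algebraMap ℤ_[p] R z * r) = PadicInt.toZModPow k z * lam r)
  (exp : ZMod (p ^ k) →+ MuCarrier K (p ^ k))
  (hexp : ∀ (g : absoluteGaloisGroup K) (x : ZMod (p ^ k)),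
    exp (cyclotomicCharacterModPow K p k g * x) = mu K (p ^ k) g (exp x))

namespace DualityDatum

/-- **The `ℤ/p^k`-reading of the induced local pairing is the local Tate pairing against `Θ_* y`**:
`ι_v (H²(exp ∘ λ)(x ∪_e y)) = ⟨x, Θ_* y⟩_v`, as the value of the bi-additive map
`(localTatePairingZMod ρ (p^k) v ι_v).compl₂ (H¹(Θ_v))`. [cite: Howard2004HeegnerKolyvagin, §1.3 H.4 (arXiv p. 7, L78–82)]
[cite: MilneADT2006, Ch. I, Cor. 2.3] -/
theorem localCupZMod_apply [Finite M] (v : Place K) (ι : galoisCohomology ((mu K (p ^ k)).toLocal v) 2 →+ ZMod (p ^ k))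
    (x : galoisCohomology (ρ.toLocal v) 1) (y : galoisCohomology ((cd.twist ρ).toLocal v) 1) :
    ι (cohomologyMap (D.expLamLocalHom lam hlam exp hexp v) 2 (D.localCup v x y)) =
      (localTatePairingZMod ρ (p ^ k) v ι).compl₂
        (galoisCohomology.map (Literature.NumberTheory.EllipticCurves.DiscreteGaloisModule.localMap
          (D.toTateDual lam hlam exp hexp) v) 1) x y := by
  rw [AddMonoidHom.compl₂_apply, localTatePairingZMod_apply, D.cohomologyMap_localCup_eq_localTatePairing lam hlam exp hexp]

/-- **(Nondeg), left**: if the local Tate pairing against `ι_v` has injective left adjoint and `Θ` is bijective, the reading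
`x ↦ (y ↦ ι_v H²(exp∘λ)(x ∪_e y))` is injective on `H¹(K_v, T)`. [cite: Howard2004HeegnerKolyvagin, §1.3 H.4] [cite: MilneADT2006, Ch. I, Cor. 2.3] -/
theorem injective_localCupZMod [Finite M] (hΘ : Bijective (D.toTateDual lam hlam exp hexp)) (v : Place K)
    (ι : galoisCohomology ((mu K (p ^ k)).toLocal v) 2 →+ ZMod (p ^ k))
    (hι : Injective (localTatePairingZMod ρ (p ^ k) v ι)) :
    Injective ((localTatePairingZMod ρ (p ^ k) v ι).compl₂
      (galoisCohomology.map (Literature.NumberTheory.EllipticCurves.DiscreteGaloisModule.localMap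
        (D.toTateDual lam hlam exp hexp) v) 1)) := by
  have hsurj := galoisCohomology.map_one_surjective_of_bijective
    (Literature.NumberTheory.EllipticCurves.DiscreteGaloisModule.localMap (D.toTateDual lam hlam exp hexp) v) hΘ
  refine (injective_iff_map_eq_zero _).mpr fun x hx ↦ (injective_iff_map_eq_zero _).mp hι x ?_
  refine AddMonoidHom.ext fun z ↦ ?_
  obtain ⟨y, rfl⟩ := hsurj z
  have h := DFunLike.congr_fun hx y
  rwa [AddMonoidHom.compl₂_apply, AddMonoidHom.zero_apply] at h

/-- **(Nondeg), right**: if the local Tate pairing against `ι_v` has injective right adjoint and `Θ` is bijective, the reading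
`y ↦ (x ↦ ι_v H²(exp∘λ)(x ∪_e y))` is injective on `H¹(K_v, Tw T)`. [cite: Howard2004HeegnerKolyvagin, §1.3 H.4] [cite: MilneADT2006, Ch. I, Cor. 2.3] -/
theorem injective_localCupZMod_flip [Finite M] (hΘ : Bijective (D.toTateDual lam hlam exp hexp)) (v : Place K)
    (ι : galoisCohomology ((mu K (p ^ k)).toLocal v) 2 →+ ZMod (p ^ k))
    (hι' : Injective (localTatePairingZMod ρ (p ^ k) v ι).flip) :
    Injective ((localTatePairingZMod ρ (p ^ k) v ι).compl₂
      (galoisCohomology.map (Literature.NumberTheory.EllipticCurves.DiscreteGaloisModule.localMap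
        (D.toTateDual lam hlam exp hexp) v) 1)).flip := by
  have hinj := galoisCohomology.map_one_injective_of_bijective
    (Literature.NumberTheory.EllipticCurves.DiscreteGaloisModule.localMap (D.toTateDual lam hlam exp hexp) v) hΘ
  intro y y' h
  apply hinj
  apply hι'
  refine AddMonoidHom.ext fun x ↦ ?_
  have hx := DFunLike.congr_fun h x
  rwa [AddMonoidHom.flip_apply, AddMonoidHom.flip_apply, AddMonoidHom.compl₂_apply, AddMonoidHom.compl₂_apply] at hx

/-- **(Perf): the double annihilator under the `ℤ/p^k`-reading of the induced local pairing.**  At a finite place `v`, for `T`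
finite killed by `p^k`, `Θ` bijective and `ι_v` making the local Tate pairing of `T` non-degenerate on both sides: if
`y ∈ H¹(K_v, Tw T)` pairs to zero with every `x` annihilating the subgroup `𝒯`, then `y ∈ 𝒯` (`#𝒯^⊥ · #𝒯 = #H¹`; the groups
`H¹(K_v, ·)` are finite, Milne I Cor. 2.3). [cite: Howard2004HeegnerKolyvagin, §1.3 H.4 and Def. 3.2.6] [cite: MilneADT2006, Ch. I, Cor. 2.3 and Prop. 0.19] -/
theorem mem_of_forall_localCupZMod_annihilator_eq_zero [Finite M] (hM : ∀ m : M, (p ^ k) • m = 0)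
    (hΘ : Bijective (D.toTateDual lam hlam exp hexp)) (v : HeightOneSpectrum (𝓞 K))
    (ι : galoisCohomology ((mu K (p ^ k)).toLocal (Sum.inr v)) 2 →+ ZMod (p ^ k))
    (hι : Injective (localTatePairingZMod ρ (p ^ k) (Sum.inr v) ι))
    (hι' : Injective (localTatePairingZMod ρ (p ^ k) (Sum.inr v) ι).flip)
    (𝒯 : AddSubgroup (galoisCohomology ((cd.twist ρ).toLocal (Sum.inr v)) 1))
    (y : galoisCohomology ((cd.twist ρ).toLocal (Sum.inr v)) 1)
    (hy : ∀ x : galoisCohomology (ρ.toLocal (Sum.inr v)) 1,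
      (∀ t ∈ 𝒯, ι (cohomologyMap (D.expLamLocalHom lam hlam exp hexp (Sum.inr v)) 2 (D.localCup (Sum.inr v) x t)) = 0) →
        ι (cohomologyMap (D.expLamLocalHom lam hlam exp hexp (Sum.inr v)) 2 (D.localCup (Sum.inr v) x y)) = 0) :
    y ∈ 𝒯 := by
  haveI : NeZero (p ^ k) := ⟨pow_ne_zero k (Fact.out : p.Prime).ne_zero⟩
  haveI := finite_galoisCohomology_one_toLocal ρ v
  haveI := finite_galoisCohomology_one_toLocal (cd.twist ρ) v
  refine Tower.mem_of_forall_pairing_annihilator_eq_zero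
    ((localTatePairingZMod ρ (p ^ k) (Sum.inr v) ι).compl₂
      (galoisCohomology.map (Literature.NumberTheory.EllipticCurves.DiscreteGaloisModule.localMap
        (D.toTateDual lam hlam exp hexp) (Sum.inr v)) 1))
    (fun x ↦ galoisCohomology.nsmul_eq_zero_of_forall _ hM x)
    (fun y ↦ galoisCohomology.nsmul_eq_zero_of_forall _ hM y)
    (D.injective_localCupZMod lam hlam exp hexp hΘ _ ι hι) (D.injective_localCupZMod_flip lam hlam exp hexp hΘ _ ι hι')
    𝒯 y fun x hx ↦ ?_
  rw [← D.localCupZMod_apply lam hlam exp hexp]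
  exact hy x fun t ht ↦ by rw [D.localCupZMod_apply lam hlam exp hexp]; exact hx t ht

/-- **(Nondeg) and (Perf) from the Poitou–Tate family**: with `inv : LocalInvariants K (p^k)` satisfying `IsPerfect` (first
conjunct of `poitouTate_selmerStructure_duality K`), both adjoints of the `ℤ/p^k`-reading through `inv_v` are injective at
every finite place. [cite: Howard2004HeegnerKolyvagin, §1.3 H.4] [cite: MilneADT2006, Ch. I, Cor. 2.3] -/
theorem injective_localCupZMod_of_isPerfect [Finite M] (hM : ∀ m : M, (p ^ k) • m = 0)
    (hΘ : Bijective (D.toTateDual lam hlam exp hexp)) (inv : LocalInvariants K (p ^ k)) (hperf : inv.IsPerfect)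
    (v : HeightOneSpectrum (𝓞 K)) :
    Injective ((localTatePairingZMod ρ (p ^ k) (Sum.inr v) (inv (Sum.inr v))).compl₂
        (galoisCohomology.map (Literature.NumberTheory.EllipticCurves.DiscreteGaloisModule.localMap
          (D.toTateDual lam hlam exp hexp) (Sum.inr v)) 1)) ∧
      Injective ((localTatePairingZMod ρ (p ^ k) (Sum.inr v) (inv (Sum.inr v))).compl₂
        (galoisCohomology.map (Literature.NumberTheory.EllipticCurves.DiscreteGaloisModule.localMap
          (D.toTateDual lam hlam exp hexp) (Sum.inr v)) 1)).flip :=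
  ⟨D.injective_localCupZMod lam hlam exp hexp hΘ _ _ ((hperf v).2 ρ hM).1.1,
    D.injective_localCupZMod_flip lam hlam exp hexp hΘ _ _ ((hperf v).2 ρ hM).2.1⟩

/-- **(Perf) from the Poitou–Tate family**, packaged for the H.4 descent (`Tower.mem_levelCondition_top_of_forall_pairing_bot_eq_zero`'s
`hPerf` at level `k`, read through `inv_v`). [cite: Howard2004HeegnerKolyvagin, §1.3 H.4 and Def. 3.2.6] [cite: MilneADT2006, Ch. I, Cor. 2.3] -/
theorem mem_of_forall_localCupZMod_annihilator_eq_zero_of_isPerfect [Finite M] (hM : ∀ m : M, (p ^ k) • m = 0)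
    (hΘ : Bijective (D.toTateDual lam hlam exp hexp)) (inv : LocalInvariants K (p ^ k)) (hperf : inv.IsPerfect)
    (v : HeightOneSpectrum (𝓞 K)) (𝒯 : AddSubgroup (galoisCohomology ((cd.twist ρ).toLocal (Sum.inr v)) 1))
    (y : galoisCohomology ((cd.twist ρ).toLocal (Sum.inr v)) 1)
    (hy : ∀ x : galoisCohomology (ρ.toLocal (Sum.inr v)) 1,
      (∀ t ∈ 𝒯, inv (Sum.inr v) (cohomologyMap (D.expLamLocalHom lam hlam exp hexp (Sum.inr v)) 2
          (D.localCup (Sum.inr v) x t)) = 0) →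
        inv (Sum.inr v) (cohomologyMap (D.expLamLocalHom lam hlam exp hexp (Sum.inr v)) 2
          (D.localCup (Sum.inr v) x y)) = 0) :
    y ∈ 𝒯 :=
  D.mem_of_forall_localCupZMod_annihilator_eq_zero lam hlam exp hexp hM hΘ v _ ((hperf v).2 ρ hM).1.1
    ((hperf v).2 ρ hM).2.1 𝒯 y hy

end DualityDatum

end Literature.NumberTheory.GaloisCohomology.Howard2004

end
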